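import Literature.Computability.Cryptography.QubitRegister
import HarnessLib

/-!
# The gate alphabet of Toffoli+Hadamard is encodable

Topic `Literature/Computability/Cryptography`; a small piece of infrastructure for the tree's
Toffoli+Hadamard gate set `toffoliH : QGateSet` (`QubitRegister.lean`; symbols `H, X, CNOT, TOF`,
Shi 2003, Aharonov 2003).

The symbol type `toffoliH.Op` is *by definition* the inductive type `ToffoliHOp`, which carries
`Encodable`, `DecidableEq` and `Fintype` instances; but `toffoliH` is an ordinary (non-reducible)
definition, so instance search does not see through the projection `toffoliH.Op` and finds none of
them. In particular poly-time uniformity of a circuit family, `QCircuitFamily.IsUniform`, which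
serialises the gate symbols through `[Encodable G.Op]` (descriptions of uniform circuit families:
Yao 1993; Bernstein–Vazirani 1997, §8), did not elaborate for Toffoli+H families, and statements
about uniform Toffoli+H families had to inline the instance as
`@QCircuitFamily.IsUniform toffoliH (inferInstanceAs (Encodable ToffoliHOp)) F`.

This file transports the instances along the definitional equality `toffoliH.Op = ToffoliHOp`,
exactly as `instEncodableOpCliffordT : Encodable cliffordT.Op := inferInstanceAs (Encodable CliffordTOp)`
(`ClassBQP.lean`) does for Clifford+T:

* `instEncodableOpToffoliH : Encodable toffoliH.Op := inferInstanceAs (Encodable ToffoliHOp)` —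
  literally the term inlined by the existing statements. CAVEAT (checked, see Design notes): in the
  present toolchain `inferInstanceAs` re-elaborates the transported structure at EACH occurrence into
  `{ encode := ‹occurrence›._aux_1, decode := ‹occurrence›._aux_3, encodek := _ }` with
  occurrence-specific auxiliary constants (the same is true of `instEncodableOpCliffordT`), so an
  inlined occurrence and this instance are definitionally equal by unfolding (`rfl`, `Iff.rfl`,
  `exact h`, `change` all work: e.g.
  `@QCircuitFamily.IsUniform toffoliH (inferInstanceAs (Encodable ToffoliHOp)) = @QCircuitFamily.IsUniform toffoliH instEncodableOpToffoliH`
  holds by `rfl`) but NOT syntactically or reducibly equal (`with_reducible rfl` fails), hence not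
  interchangeable by `rw`/`simp` matching; convert by `exact`/`change`, then work with the instance;
* `instDecidableEqOpToffoliH`, `instFintypeOpToffoliH` — the same transport for decidable
  equality and finiteness of the alphabet;
* API: `toffoliH_op` (`toffoliH.Op = ToffoliHOp`), `encode_toffoliHOp` (the codes
  `H ↦ 0, X ↦ 1, CNOT ↦ 2, TOF ↦ 3` fixed in `QubitRegister.lean`), `encode_toffoliH_op` (encoding a
  symbol of `toffoliH.Op` is encoding it in `ToffoliHOp`), `card_toffoliH_op` (four symbols).

## References

* Y. Shi, *Both Toffoli and controlled-NOT need little help to do universal quantum computing*,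
  Quantum Inf. Comput. 3 (2003) 84–92 [Shi2003] — the gate set `{H, X, CNOT, TOF}`.
* E. Bernstein, U. Vazirani, *Quantum complexity theory*, SIAM J. Comput. 26 (1997), §8
  [BernsteinVazirani1997] — uniform families are given by finite descriptions of their gates, whence
  the need for an encoding of the gate alphabet.

## Design notes

* No new mathematics: every declaration is a transport by `inferInstanceAs` or holds by `rfl` /
  case analysis. The instances duplicate no Mathlib instance (the carrier is a project type) and
  create no diamond: any instance obtained by this transport unfolds to the fields of the
  `Encodable.ofEquiv (Fin 4)` instance on `ToffoliHOp` (`encode_toffoliH_op`, `decode_toffoliH_op`,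
  both `rfl`), so all of them are definitionally equal at the default transparency.
* Why no rewrite lemma `@IsUniform toffoliH (inferInstanceAs …) F ↔ F.IsUniform`: its left-hand side
  would carry this file's own auxiliary constants and would not match (syntactically) the inlined
  occurrences in other files; the conversion is by definitional unfolding (`Iff.rfl` / `exact`) at
  the point of use, which needs no lemma.
* Deliberately not here: uniformity of concrete Toffoli+H families, exact transport of families
  between gate sets (`GateSetTransport.lean`), universality of Toffoli+H (Shi 2003; Aharonov 2003),
  polynomial-time computability of the gate entries (`CliffordTPolyTimeEntries.lean`,
  `toffoliH_polyTimeEntries`).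
-/

namespace Literature.Computability.Cryptography

/-- The symbol type of the Toffoli+Hadamard gate set `toffoliH` is, by definition of `toffoliH`,
the inductive type `ToffoliHOp` (`H, X, CNOT, TOF`). (Shi 2003.) [folklore] -/
theorem toffoliH_op : toffoliH.Op = ToffoliHOp := rfl

/-- The `Encodable` structure on the gate alphabet of Toffoli+Hadamard, transported from
`ToffoliHOp` (to which `toffoliH.Op` is definitionally equal); needed because `toffoliH` is a
definition and instance search does not unfold it, so that e.g. `QCircuitFamily.IsUniform F`
elaborates for families `F : QCircuitFamily toffoliH`. It is defined by *the term*
`inferInstanceAs (Encodable ToffoliHOp)` that statements about uniform Toffoli+H families used to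
inline, and is definitionally equal to every such inlined occurrence by unfolding (`rfl` / `exact`;
not syntactically — see the module docstring); cf. `instEncodableOpCliffordT`.
(Bernstein–Vazirani 1997, §8, for the role of gate codes in uniformity.) [folklore] -/
instance instEncodableOpToffoliH : Encodable toffoliH.Op := inferInstanceAs (Encodable ToffoliHOp)

/-- Decidable equality on the gate alphabet of Toffoli+Hadamard, transported from `ToffoliHOp`.
[folklore] -/
instance instDecidableEqOpToffoliH : DecidableEq toffoliH.Op := inferInstanceAs (DecidableEq ToffoliHOp)

/-- The gate alphabet of Toffoli+Hadamard is a finite type (four symbols), transported from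
`ToffoliHOp`. [folklore] -/
instance instFintypeOpToffoliH : Fintype toffoliH.Op := inferInstanceAs (Fintype ToffoliHOp)

/-- The codes of the Toffoli+Hadamard symbols fixed by the `Encodable ToffoliHOp` instance of
`QubitRegister.lean`: `H ↦ 0`, `X ↦ 1`, `CNOT ↦ 2`, `TOF ↦ 3`. [folklore] -/
theorem encode_toffoliHOp (g : ToffoliHOp) :
    Encodable.encode g = (match g with | .H => 0 | .X => 1 | .CNOT => 2 | .TOF => 3 : ℕ) := by
  cases g <;> rfl

/-- Encoding a gate symbol of `toffoliH.Op` (through the transported instance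
`instEncodableOpToffoliH`) is encoding it as an element of `ToffoliHOp`. [folklore] -/
theorem encode_toffoliH_op (g : toffoliH.Op) :
    Encodable.encode g = Encodable.encode (show ToffoliHOp from g) := rfl

/-- Decoding into `toffoliH.Op` (through `instEncodableOpToffoliH`) is decoding into `ToffoliHOp`.
[folklore] -/
theorem decode_toffoliH_op (n : ℕ) :
    (Encodable.decode n : Option toffoliH.Op) = (show Option toffoliH.Op from (Encodable.decode n : Option ToffoliHOp)) :=
  rfl

/-- The Toffoli+Hadamard gate alphabet has exactly four symbols. [folklore] -/
theorem card_toffoliH_op : Fintype.card toffoliH.Op = 4 := rfl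

end Literature.Computability.Cryptography
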